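import Summits.CriticalPhenomena.Ising3D.Control2DBootstrap

/-!
# The 2D Ising blind control, class 1 (two-sided): what a cover by kind-`box` certificates asserts
(cell `pub-ising3x`, seat controls-1 gen 8; `SCOPE.md` §4 `### controls-1 v10`, rung B1′-a, round RB-2a)

HONEST FRAMING: lottery ticket; floor = tightest certified 3D Ising CFT bounds; no exact-solution
claim without a proof. CONTROL-ONLY: the two-dimensional axiom set `A2D′` below (de la Fuente,
arXiv:1904.09801: `ε` the only `ℤ₂`-even scalar quasi-primary below a gap `G`, the stress tensor plus
a spin-2 gap `δ`, unitarity) is NOT the three-dimensional floor's axiom set.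

`Control2DBootstrap.lean` types the class-2 (one-sided) item `GapExcluded s U` ("`Δ_ε < U`"). The
class-1 item of the control is a TWO-SIDED interval for `Δ_ε` at fixed `Δ_σ = s`, obtained from
(i) finitely many kind-`box` certificates (format `deriv-functional-2d/2`, verifiers
`verify_A2d.py ≥ 2.0` and `verify_B2d.py ≥ 2.0`, `HOME/pub-ising3x-controls-1/RB2/`), each asserting
`BoxExcluded s G δ e₁ e₂`: no unitary parity-symmetric solution of the `⟨σσσσ⟩` sum rule at
`Δ_σ = s` has all its scalars in `[e₁, e₂] ∪ [G, ∞)` and all its spin-2 quasi-primaries in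
`{2} ∪ [2 + δ, ∞)`; and (ii) one class-2 certificate `GapExcluded s U` with `U ≤ G`.
This file PROVES the elementary logic that assembles them (`cover_box.py` checks the same thing on
exact rationals): box exclusion is pointwise exclusion of the `ε` location (`BoxExcluded.excludedAt`),
pointwise exclusions on `[a, b]` and `[b, c]` give `[a, c]` (`excludedOn_union`), the gap certificate
excludes every location `x ≥ U` once `U ≤ G` (`excludedAt_of_gapExcluded`), and together they give
the two-sided statement `TwoSided s G δ w ε_lo U`: every `A2D′` datum whose `ε` sits at `x ≥ w`
has `ε_lo < x < U` (`twoSided_of_cover`). NOTHING numerical is asserted here: the certificates are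
external exact-arithmetic objects (two independent readers), not kernel terms; the window `w` is part
of the statement (at derivative order 11 a second allowed window near `2Δ_σ` exists below it).

WARNING on what does NOT follow: two box exclusions `[e₁,e₂]`, `[e₂,e₃]` do not give the box
exclusion `[e₁,e₃]` for data with SEVERAL scalars below `G` (one in each box) — which is why the
assembled statement quantifies over data whose sub-gap scalars sit at ONE location `x` (`A2D′`
proper), exactly as the published single-correlator island assumptions do.

Sources: the sum rule and the linear-functional exclusion logic, R. Rattazzi, V. S. Rychkov,
E. Tonni, A. Vichi, JHEP 12 (2008) 031, §3–§5; the 2D single-correlator island axiom set,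
A. de la Fuente, arXiv:1904.09801, §2. Tree: `CrossingData`, `IsUnitary`, `SatisfiesCrossing`,
`HasScalarGap`, `GapExcluded` from `Control2DBootstrap.lean`.
-/

namespace Summit.CriticalPhenomena.Ising3D.Control2D

open Set

namespace CrossingData

/-- All scalar (`ℓ = 0`) quasi-primaries of the datum have their dimensions in `S`.
[cite: RattazziEtAl2008, §5] -/
def ScalarsIn (D : CrossingData) (S : Set ℝ) : Prop :=
  ∀ i, D.spin i = 0 → D.Δ i ∈ S

/-- All spin-2 quasi-primaries of the datum have their dimensions in `S` (for `A2D′`: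
`S = {2} ∪ [2 + δ, ∞)`, the stress tensor plus a spin-2 gap). [cite: RattazziEtAl2008, §5] -/
def SpinTwoIn (D : CrossingData) (S : Set ℝ) : Prop :=
  ∀ i, D.spin i = 2 → D.Δ i ∈ S

/-- Shrinking the allowed scalar set preserves membership. Elementary. [folklore] -/
theorem ScalarsIn.mono {D : CrossingData} {S T : Set ℝ} (h : D.ScalarsIn S) (hST : S ⊆ T) :
    D.ScalarsIn T :=
  fun i hi => hST (h i hi)

end CrossingData

/-- **Kind-`box` exclusion** (format `deriv-functional-2d/2`): no parity-symmetric unitary solution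
of the 2D `⟨σσσσ⟩` sum rule at `Δ_σ = s` has all its scalars in `[e₁, e₂] ∪ [G, ∞)` and all its
spin-2 quasi-primaries in `{2} ∪ [2 + δ, ∞)` (even spins `ℓ ≥ 4`: unitarity `Δ ≥ ℓ` only, part of
`IsUnitary`). [cite: RattazziEtAl2008, §5] -/
def BoxExcluded (s G δ e₁ e₂ : ℝ) : Prop :=
  ∀ D : CrossingData, D.IsUnitary → D.SatisfiesCrossing s →
    D.ScalarsIn (Icc e₁ e₂ ∪ Ici G) → D.SpinTwoIn ({2} ∪ Ici (2 + δ)) → False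

/-- **Pointwise exclusion of the `ε` location**: no `A2D′` datum at `Δ_σ = s` has its sub-gap
scalars at the single location `x` (scalars in `{x} ∪ [G, ∞)`, spin 2 in `{2} ∪ [2 + δ, ∞)`).
[cite: RattazziEtAl2008, §5] -/
def ExcludedAt (s G δ x : ℝ) : Prop :=
  ∀ D : CrossingData, D.IsUnitary → D.SatisfiesCrossing s →
    D.ScalarsIn ({x} ∪ Ici G) → D.SpinTwoIn ({2} ∪ Ici (2 + δ)) → False

/-- Exclusion of every `ε` location in a set `W`. [cite: RattazziEtAl2008, §5] -/
def ExcludedOn (s G δ : ℝ) (W : Set ℝ) : Prop :=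
  ∀ x ∈ W, ExcludedAt s G δ x

/-- A box certificate excludes every `ε` location inside its box. Elementary. [folklore] -/
theorem BoxExcluded.excludedAt {s G δ e₁ e₂ x : ℝ} (h : BoxExcluded s G δ e₁ e₂)
    (hx : x ∈ Icc e₁ e₂) : ExcludedAt s G δ x := by
  intro D hU hC hS hT
  refine h D hU hC (hS.mono ?_) hT
  intro y hy
  rcases hy with hy | hy
  · left
    rw [mem_singleton_iff] at hy
    rw [hy]
    exact hx
  · right
    exact hy

/-- A box certificate excludes its whole box of locations. Elementary. [folklore] -/
theorem BoxExcluded.excludedOn {s G δ e₁ e₂ : ℝ} (h : BoxExcluded s G δ e₁ e₂) :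
    ExcludedOn s G δ (Icc e₁ e₂) :=
  fun _ hx => h.excludedAt hx

/-- A smaller box is excluded by a larger one. Elementary. [folklore] -/
theorem BoxExcluded.mono {s G δ e₁ e₂ e₁' e₂' : ℝ} (h : BoxExcluded s G δ e₁ e₂) (h₁ : e₁ ≤ e₁')
    (h₂ : e₂' ≤ e₂) : BoxExcluded s G δ e₁' e₂' := by
  intro D hU hC hS hT
  refine h D hU hC (hS.mono ?_) hT
  exact union_subset_union (Icc_subset_Icc h₁ h₂) le_rfl

/-- Exclusion on a union of location sets. Elementary. [folklore] -/
theorem excludedOn_union {s G δ : ℝ} {W₁ W₂ : Set ℝ} (h₁ : ExcludedOn s G δ W₁)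
    (h₂ : ExcludedOn s G δ W₂) : ExcludedOn s G δ (W₁ ∪ W₂) := by
  intro x hx
  rcases hx with hx | hx
  · exact h₁ x hx
  · exact h₂ x hx

/-- **The cover step**: adjacent location intervals `[a, b]` and `[b, c]` give `[a, c]`
(`cover_box.py` checks `e₁(next) ≤ reach` on exact rationals; overlap is allowed). Elementary.
[folklore] -/
theorem excludedOn_Icc_append {s G δ a b b' c : ℝ} (h₁ : ExcludedOn s G δ (Icc a b))
    (h₂ : ExcludedOn s G δ (Icc b' c)) (hbb : b' ≤ b) : ExcludedOn s G δ (Icc a c) := by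
  intro x hx
  rcases le_or_gt x b with hxb | hxb
  · exact h₁ x ⟨hx.1, hxb⟩
  · exact h₂ x ⟨hbb.trans hxb.le, hx.2⟩

/-- **The class-2 certificate feeds the upper side**: if every unitary solution with all scalars at
`Δ ≥ U` is excluded (`GapExcluded s U`) and `U ≤ G`, then every `ε` location `x ≥ U` is excluded
under `A2D′` (its scalars lie in `{x} ∪ [G, ∞) ⊆ [U, ∞)`). Elementary. [folklore] -/
theorem excludedAt_of_gapExcluded {s G δ U x : ℝ} (h : GapExcluded s U) (hUG : U ≤ G)
    (hUx : U ≤ x) : ExcludedAt s G δ x := by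
  intro D hU hC hS _hT
  refine h D hU hC ?_
  intro i hi
  rcases hS i hi with hmem | hmem
  · rw [mem_singleton_iff] at hmem
    rw [hmem]
    exact hUx
  · exact hUG.trans hmem

/-- **The class-1 (two-sided) item, typed.** `TwoSided s G δ w ε_lo U`: in every parity-symmetric
unitary solution of the 2D `⟨σσσσ⟩` sum rule at `Δ_σ = s` satisfying `A2D′` — sub-gap scalars at a
single location `x` (scalars in `{x} ∪ [G, ∞)`), spin 2 in `{2} ∪ [2 + δ, ∞)` — with `x` in the
window `x ≥ w`, one has `ε_lo < x < U`. For the 2D Ising CFT (`Δ_σ = 1/8`, `Δ_ε = 1`, next even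
scalar quasi-primary at `4`, next spin-2 quasi-primary at `6`) this reads `ε_lo < Δ_ε < U`.
The single-correlator island statement of arXiv:1904.09801 restricted to one `Δ_σ` column.
[cite: RattazziEtAl2008, §5] -/
def TwoSided (s G δ w εlo U : ℝ) : Prop :=
  ∀ D : CrossingData, D.IsUnitary → D.SatisfiesCrossing s →
    D.SpinTwoIn ({2} ∪ Ici (2 + δ)) → ∀ x : ℝ, w ≤ x → D.ScalarsIn ({x} ∪ Ici G) →
      εlo < x ∧ x < U

/-- **Assembly of the class-1 item** (what `cover_box.py` certifies on exact rationals): pointwise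
exclusion of the locations `[w, ε_lo]` (from the box cover) plus the gap certificate `GapExcluded s U`
with `U ≤ G` give `TwoSided s G δ w ε_lo U`. PROVED (case split `x ≤ ε_lo` / `x ≥ U`).
[cite: RattazziEtAl2008, §5] -/
theorem twoSided_of_cover {s G δ w εlo U : ℝ} (hcov : ExcludedOn s G δ (Icc w εlo))
    (hgap : GapExcluded s U) (hUG : U ≤ G) : TwoSided s G δ w εlo U := by
  intro D hU hC hT x hwx hS
  constructor
  · rcases lt_or_ge εlo x with hlt | hle
    · exact hlt
    · exact (hcov x ⟨hwx, hle⟩ D hU hC hS hT).elim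
  · rcases lt_or_ge x U with hlt | hle
    · exact hlt
    · exact (excludedAt_of_gapExcluded hgap hUG hle D hU hC hS hT).elim

/-- **Assembly from a finite list of boxes** (the shape of `RB2/certs/certs.json`): consecutive boxes
`[e k, e (k+1)]`, `k ≤ n`, each excluded, cover the locations `[e 0, e (n+1)]` (no monotonicity
needed: an inverted box is an empty `Icc`, vacuously excluded, and the append step only uses the
shared endpoint). PROVED by induction on `n`. [folklore] -/
theorem excludedOn_of_chain {s G δ : ℝ} (e : ℕ → ℝ) :
    ∀ n : ℕ, (∀ k, k ≤ n → BoxExcluded s G δ (e k) (e (k + 1))) →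
      ExcludedOn s G δ (Icc (e 0) (e (n + 1))) := by
  intro n
  induction n with
  | zero =>
    intro hb
    exact (hb 0 le_rfl).excludedOn
  | succ n ih =>
    intro hb
    have h1 : ExcludedOn s G δ (Icc (e 0) (e (n + 1))) := ih (fun k hk => hb k (Nat.le_succ_of_le hk))
    have h2 : ExcludedOn s G δ (Icc (e (n + 1)) (e (n + 1 + 1))) := (hb (n + 1) le_rfl).excludedOn
    exact excludedOn_Icc_append h1 h2 le_rfl

end Summit.CriticalPhenomena.Ising3D.Control2D
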